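import Summits.ABC.IUTFork.ForkGenuineDepthBadMassExact
import Summits.ABC.IUTFork.LDHSplitBadPrimeNumberField
import Literature.IUT.LogVolume.GenuineLogThetaPerImage
import HarnessLib

/-!
# The fork at [IUTchIII] Corollary 3.12 at a GENUINE input: readings (U) and (P) PART WAYS along the one-place synthetic family —
# a kernel datum for RISK 7 (skeleton XXVIId-d)

Record-only file (D-0012) of the abc-iut cell (deliverable (a), skeleton seat abc-iut-skel, gen 8); TAKES NO SIDE.
Sequel to `ForkGenuineDepthBadMassExact.lean` (XXVIId-c, p437902: along abc-iut-w5-d018's one-place family `deepAtPlace p v₀ l N σ` at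
an unramified odd deep prime, in the cell's reading of record (U) = hull of the UNION of the (Ind1)×(Ind2)-images, the typed inequality
holds at every depth iff `S_l(β) ≤ β`, `β = Pr(v₀)`). HERE the same family is evaluated in the PER-IMAGE reading (P) of the cell
(abc-iut-S7/c312-d1's `ThetaVolumeInput.Cor312PerImageOf`, `GenuineLogThetaPerImage.lean`: the (Ind2)-orbit of the bare region at the
identity slot datum — no union over the factor permutations — then the hull; VERDICT RISK ¶7: `vol_(P) ≤ vol_(U)`, equal on slot-constant
data):

* `sum_ite_last_mul_prod_weight` — `Σ_{v⃗} [v_j = v₀]·Π Pr(v_b) = Pr(v₀)` (marginal of the last slot);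
* **`realPrimePacketWith_negLogThetaPerImageAt_eq_of_onePlace`** (any shell; `p > 2`, all `K_v` (`v | p`) unramified): for the Θ-idele
  `p^{c_i}` at `v₀`, `1` elsewhere, `−|log(Θ)|^{(P)}_p = (1/ℓ⋇)·Σ_i (−c_i·log p)·Pr(v₀)` — the bare region is twisted at the LAST slot only,
  so a summand is `−c_i·log p` exactly when `v_j = v₀` (mass `β`, not `β^{j+1}`), and (Ind2)+hull add nothing: in reading (P) the mixed
  tuples give NO relief;
* for the family: `negLogThetaPerImageLoc_deepAtPlace_eq_of_unramified` (`= −((l+1)l/12)·N·β·log p`, the bare `−deĝ̲_lgp`-share — the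
  free inequality is an EQUALITY in reading (P) here), `…_eq_of_ne` (other primes depth-free),
  **`cor312PerImageOf_deepAtPlace_iff_of_unramified`** (`Cor312PerImageOf (deepAtPlace N) ↔ ((l+1)l/12 − 1)·N·β·log p ≤ c_P + ((l+5)/4)·log π`),
  hence **`exists_not_cor312PerImageOf_deepAtPlace`**: for EVERY bad mass `β > 0` the (P)-form FAILS at some depth;
* **`readings_part_ways_deepAtPlace`** — if `S_l(β) ≤ β` then `(∀ N, Cor312Of (deepAtPlace N)) ∧ (∃ N, ¬ Cor312PerImageOf (deepAtPlace N))`: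
  the SAME synthetic inputs are on the TRUE side at every depth in reading (U) and on the FALSE side at large depth in reading (P);
  `readings_part_ways_of_weight_le_half` — the hypothesis holds whenever `Pr(v₀) ≤ 1/2` (abc-iut-w5-d018's `sum_sq_half_pow_le`), any `l`.

READING (VERDICT RISK ¶7 grammar; no side taken): along the slot-constant family `deepAt` the two readings are the same number
(abc-iut-c312-d1's `cor312Of_iff_perImage_of_slotConstant`); along the one-place family they are NOT — (U) pays the Θ-weight `j²` only on
all-bad tuples (mass `β^{j+1}`), (P) pays it on every tuple whose last slot is bad (mass `β`). So the «split-bad-prime escape» of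
`HOME/skel/FORK-INDEX.md` row 2 (TRUE at any depth for small bad mass: c312-3 p425793, w5-d018 p430071/p431095, skel XXVIId-c) is a
feature of reading (U) ONLY; in reading (P) the one-place family is eventually FALSE for every bad mass. Which number print's
`−|log(Θ)|` denotes is ref-b's locator verdict B14 ((U) at the statement, (P) proof-internal) — untouched here. HONEST SCOPE: inhabitants
of the INPUT TYPE with genuine completions but SYNTHETIC ideles, NOT initial Θ-data of [IUTchI] Def. 3.1; sharp (Ind3), full (Ind2),
Mochizuki's container; both `Cor312Of` and `Cor312PerImageOf` are the cell's CLAIM-forms, never asserted. PROOF-ONLY file: no definitions,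
no `Prop` facts. [cite: Mochizuki2012, IUTchIII Cor. 3.12 p. 173–174, proof Step (x) p. 181] [cite: Mochizuki2012, IUTchIV Prop. 1.2 p. 10,
(iv) p. 11, Thm. 1.10 Step (v)–(vii) p. 27–30] [cite: DupuyHilado2025, §1 (1.1), Def. 3.6.3, §3.6, §3.9, §4.11–4.12]
[claim: Mochizuki2012, status: disputed]
-/

noncomputable section

open Set Module Literature.IUT.LogVolume NumberField IsDedekindDomain
open scoped Pointwise

namespace Summit.ABC.IUTFork.GenuineContent

/-! ## §1 Two small identities -/

section Packet

variable (p : ℕ) [Fact p.Prime] {ι : Type} [Fintype ι] [DecidableEq ι] [Nonempty ι]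
variable (k : ι → Type) [∀ i, NontriviallyNormedField (k i)] [∀ i, NormedAlgebra ℚ_[p] (k i)]
  [∀ i, IsUltrametricDist (k i)] [∀ i, ProperSpace (k i)]

omit [Fintype ι] [Nonempty ι] [∀ i, IsUltrametricDist (k i)] [∀ i, ProperSpace (k i)] in
/-- `ι_a(c)·A = c·A` for a scalar `c ∈ ℚ_p` (`ι_a` is a `ℚ_p`-algebra map). [cite: DupuyHilado2025, §4.7] -/
theorem iota_algebraMap_smul_set (i : ι) (c : ℚ_[p]) (A : Set (PacketAlgebra p k)) :
    iota p k i (algebraMap ℚ_[p] (k i) c) • A = c • A := by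
  rw [AlgHom.commutes]
  ext y
  simp only [Set.mem_smul_set, algebraMap_smul]

end Packet

/-- **Marginal of the last slot**: `Σ_{v⃗ ∈ V_p^{n+1}} [v_n = v₀]·a·Π_b Pr(v_b) = a·Pr(v₀)` (the other slots sum to `1`).
[cite: DupuyHilado2025, §3.6] -/
theorem sum_ite_last_mul_prod_weight {F : Type} [Field F] [NumberField F] (p : ℕ) [Fact p.Prime]
    [DecidableEq (placesOver F p)] (v₀ : placesOver F p) (n : ℕ) (a : ℝ) :
    ∑ e : Fin (n + 1) → placesOver F p, (if e (Fin.last n) = v₀ then a else 0) * ∏ b, weight F (e b).1 =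
      a * weight F v₀.1 := by
  classical
  have hsum : ∑ v : placesOver F p, weight F v.1 = 1 := (localWeights F p).sum_pr
  -- rewrite each term as `a` times a product of slot factors
  have hterm : ∀ e : Fin (n + 1) → placesOver F p,
      (if e (Fin.last n) = v₀ then a else 0) * ∏ b, weight F (e b).1 =
        a * ∏ b, (weight F (e b).1 * if b = Fin.last n then (if e b = v₀ then 1 else 0) else 1) := by
    intro e
    rw [Finset.prod_mul_distrib, Fintype.prod_ite_eq']
    split_ifs <;> ring
  rw [Finset.sum_congr rfl fun e _ => hterm e, ← Finset.mul_sum]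
  congr 1
  have h := Finset.prod_univ_sum (t := fun _ : Fin (n + 1) => (Finset.univ : Finset (placesOver F p)))
    (f := fun b v => weight F v.1 * if b = Fin.last n then (if v = v₀ then 1 else 0) else 1)
  rw [Fintype.piFinset_univ] at h
  rw [← h]
  have hfac : ∀ b : Fin (n + 1), (∑ v : placesOver F p,
      weight F v.1 * if b = Fin.last n then (if v = v₀ then (1 : ℝ) else 0) else 1) =
      if b = Fin.last n then weight F v₀.1 else 1 := by
    intro b
    split_ifs with hb
    · rw [Finset.sum_eq_single v₀ (fun v _ hv => by rw [if_neg hv, mul_zero]) (fun h => absurd (Finset.mem_univ _) h),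
        if_pos rfl, mul_one]
    · simp only [mul_one, hsum]
  rw [Finset.prod_congr rfl fun b _ => hfac b, Fintype.prod_ite_eq']

/-! ## §2 Reading (P) for a Θ-idele concentrated at one place of an unramified odd prime -/

section OnePlace

variable {F : Type} [Field F] [NumberField F]
variable (p : ℕ) [hp : Fact p.Prime] (𝔽 : LocalFields F p)
variable (c : (j : ℕ) → (Fin (j + 1) → placesOver F p) → ℚ_[p]) (hc0 : ∀ j e, c j e ≠ 0)
  (hcσ : ∀ (j : ℕ) (σ : Equiv.Perm (Fin (j + 1))) (e : Fin (j + 1) → placesOver F p), c j (e ∘ σ) = c j e)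

/-- The bare Θ-region at a summand of degree `j = i+1` is the translate `ι_j(t_{i,v_j})·(R_{v⃗})^∼` (twist at the LAST slot).
[cite: DupuyHilado2025, §3.9] -/
theorem realPrimePacketWith_pilotRegion_eq_smul {lstar : ℕ} (t : Fin lstar → (v : placesOver F p) → (𝔽.k v)ˣ)
    (i : Fin lstar) (e : Fin ((i : ℕ) + 1 + 1) → placesOver F p) :
    (realPrimePacketWith p 𝔽 c hc0 hcσ).pilotRegion t ((i : ℕ) + 1) e =
      iota p (fun b => 𝔽.k (e b)) (Fin.last _) (t i (e (Fin.last _)) : 𝔽.k (e (Fin.last _))) •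
        (normalizedPacket p (fun b => 𝔽.k (e b)) : Set (PacketAlgebra p (fun b => 𝔽.k (e b)))) := by
  have hidx : 0 < (i : ℕ) + 1 ∧ (i : ℕ) + 1 - 1 < lstar := ⟨Nat.succ_pos _, by simp⟩
  unfold PrimePacket.pilotRegion
  rw [dif_pos hidx]
  have hfin : (⟨(i : ℕ) + 1 - 1, hidx.2⟩ : Fin lstar) = i := Fin.ext (by simp)
  rw [hfin]
  rfl

/-- **`−|log(Θ)|^{(P)}_p` for a Θ-idele concentrated at ONE place of an unramified odd prime** (real packet, ANY shell scalar): if `p > 2`,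
every `K_v` (`v | p`) is absolutely unramified, `t_{i,v₀} = p^{c_i}` and `t_{i,v} = 1` for `v ≠ v₀`, then
`−|log(Θ)|^{(P)}_p = (1/ℓ⋇)·Σ_i (−c_i·log p)·Pr(v₀)`: a summand is `−c_i·log p` iff its LAST slot is `v₀` (the bare region is twisted at
the last slot only; the (Ind2)-orbit of `p^{c_i}·(R_{v⃗})^∼` is itself), `0` otherwise. [cite: Mochizuki2012, IUTchIII Cor. 3.12 proof Step (x) p. 181]
[cite: Mochizuki2012, IUTchIV Thm. 1.10 Step (v)–(vi) p. 27–29] [cite: DupuyHilado2025, Def. 3.6.3, §3.6, §4.11–4.12] [claim: Mochizuki2012, status: disputed] -/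
theorem realPrimePacketWith_negLogThetaPerImageAt_eq_of_onePlace (hp2 : 2 < p)
    (he : ∀ v : placesOver F p, absRamificationIdx p (𝔽.k v) = 1) (v₀ : placesOver F p) {lstar : ℕ}
    (t : Fin lstar → (v : placesOver F p) → (𝔽.k v)ˣ) (cexp : Fin lstar → ℕ)
    (hbad : ∀ (i : Fin lstar) (v : placesOver F p), v = v₀ →
      (t i v : 𝔽.k v) = algebraMap ℚ_[p] (𝔽.k v) ((p : ℚ_[p]) ^ cexp i))
    (hgood : ∀ (i : Fin lstar) (v : placesOver F p), v ≠ v₀ → (t i v : 𝔽.k v) = 1) :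
    (realPrimePacketWith p 𝔽 c hc0 hcσ).negLogThetaPerImageAt lstar t =
      (1 / (lstar : ℝ)) * ∑ i : Fin lstar, -((cexp i : ℝ) * Real.log p) * weight F v₀.1 := by
  classical
  have hval : ∀ (i : Fin lstar) (e : Fin ((i : ℕ) + 1 + 1) → placesOver F p),
      (realPrimePacketWith p 𝔽 c hc0 hcσ).logμ ((realPrimePacketWith p 𝔽 c hc0 hcσ).slotImagesHull
        ((realPrimePacketWith p 𝔽 c hc0 hcσ).pilotRegion t) ((i : ℕ) + 1) e) =
        if e (Fin.last _) = v₀ then -((cexp i : ℝ) * Real.log p) else 0 := by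
    intro i e
    have hI : 2 ≤ Fintype.card (Fin ((i : ℕ) + 1 + 1)) := by simp
    have hS : (realPrimePacketWith p 𝔽 c hc0 hcσ).slotImages ((realPrimePacketWith p 𝔽 c hc0 hcσ).pilotRegion t)
        ((i : ℕ) + 1) e =
        ⋃ g : indTwo p (fun b => 𝔽.k (e b)),
          g • (iota p (fun b => 𝔽.k (e b)) (Fin.last _) (t i (e (Fin.last _)) : 𝔽.k (e (Fin.last _))) •
            (normalizedPacket p (fun b => 𝔽.k (e b)) : Set (PacketAlgebra p (fun b => 𝔽.k (e b))))) := by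
      unfold PrimePacket.slotImages
      rw [realPrimePacketWith_pilotRegion_eq_smul p 𝔽 c hc0 hcσ t i e]
      rfl
    change packetLogμ p (fun b => 𝔽.k (e b)) (packetHull p (fun b => 𝔽.k (e b))
      ((realPrimePacketWith p 𝔽 c hc0 hcσ).slotImages ((realPrimePacketWith p 𝔽 c hc0 hcσ).pilotRegion t)
        ((i : ℕ) + 1) e)) = _
    rw [hS]
    by_cases hlast : e (Fin.last _) = v₀
    · rw [if_pos hlast, hbad i _ hlast, iota_algebraMap_smul_set,
        iUnion_indTwo_smul_smul_normalizedPacket_eq p (fun b => 𝔽.k (e b)) hI hp2 (fun b => he (e b)) _,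
        ← zpow_natCast, ← ppow_smul_set_eq, packetHull_smul_normalizedPacket,
        packetLogμ_ppow_smul p _ _ (packetAdm_normalizedPacket p _), packetLogμ_normalizedPacket, add_zero]
      push_cast
      ring
    · rw [if_neg hlast, hgood i _ hlast, map_one, one_smul]
      have h1 := iUnion_indTwo_smul_smul_normalizedPacket_eq p (fun b => 𝔽.k (e b)) hI hp2 (fun b => he (e b)) 1
      rw [one_smul] at h1
      rw [h1, packetHull_normalizedPacket]
      exact packetLogμ_normalizedPacket p _
  unfold PrimePacket.negLogThetaPerImageAt PrimePacket.lnνLp PrimePacket.lnνTensorPower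
  refine congrArg (fun x : ℝ => (1 / (lstar : ℝ)) * x) (Finset.sum_congr rfl fun i _ => ?_)
  rw [Finset.sum_congr rfl fun e _ => by rw [hval i e], sum_ite_last_mul_prod_weight]

end OnePlace

/-! ## §3 The one-place family in reading (P): eventually FALSE for EVERY bad mass; the two readings part ways -/

section DeepAtPlace

variable {F₀ : Type} [Field F₀] [NumberField F₀] {K : Type} [Field K] [NumberField K] [Algebra F₀ K]
variable (p : ℕ) [hp : Fact p.Prime] (v₀ : placesOver F₀ p) (l : ℕ) (hl : l.Prime) (h5 : 5 ≤ l) (σ : PlaceSection F₀ K)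

/-- **THE DEEP PRIME'S (P)-SUMMAND, EXACTLY**: if `p > 2` and every `K_{v̲}` (`v | p`) is absolutely unramified, then for every depth `N`
`negLogThetaPerImageLoc (deepAtPlace p v₀ l N σ) p = −((l+1)l/12)·N·β·log p` (`β = Pr(v₀)`) — the bare `−deĝ̲_lgp`-share of `p`: in reading (P)
the mixed tuples give no relief and the indeterminacies no inflation. [cite: Mochizuki2012, IUTchIII Cor. 3.12 proof Step (x) p. 181]
[cite: DupuyHilado2025, §3.6, Def. 3.6.3] [claim: Mochizuki2012, status: disputed] -/
theorem negLogThetaPerImageLoc_deepAtPlace_eq_of_unramified (hp2 : 2 < p)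
    (hunram : ∀ v : placesOver F₀ p, absRamificationIdx p ((σ.localFieldFamily p hp.out).k v) = 1) (N : ℕ) (hN : 0 < N) :
    (ThetaVolumeInput.deepAtPlace p v₀ l hl h5 N hN σ).negLogThetaPerImageLoc p =
      -(((l : ℝ) + 1) * l / 12 * ((N : ℝ) * weight F₀ v₀.1 * Real.log p)) := by
  rw [(ThetaVolumeInput.deepAtPlace p v₀ l hl h5 N hN σ).negLogThetaPerImageLoc_of_prime hp.out]
  have h := realPrimePacketWith_negLogThetaPerImageAt_eq_of_onePlace p
    ((ThetaVolumeInput.deepAtPlace p v₀ l hl h5 N hN σ).σ.localFieldFamily p hp.out)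
    (mScale p ((ThetaVolumeInput.deepAtPlace p v₀ l hl h5 N hN σ).σ.localFieldFamily p hp.out))
    (mScale_ne_zero p ((ThetaVolumeInput.deepAtPlace p v₀ l hl h5 N hN σ).σ.localFieldFamily p hp.out))
    (mScale_perm p ((ThetaVolumeInput.deepAtPlace p v₀ l hl h5 N hN σ).σ.localFieldFamily p hp.out)) hp2 hunram v₀
    ((ThetaVolumeInput.deepAtPlace p v₀ l hl h5 N hN σ).tΘ p hp.out) (fun i => ((i : ℕ) + 1) ^ 2 * N)
    (fun i v hv => coe_tΘ_deepAtPlace_of_eq p v₀ l hl h5 σ N hN i v hv)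
    (fun i v hv => coe_tΘ_deepAtPlace_of_ne p v₀ l hl h5 σ N hN hp.out i v (fun h => hv (Subtype.ext h)))
  refine h.trans ?_
  change (1 / (((l - 1) / 2 : ℕ) : ℝ)) * ∑ i : Fin ((l - 1) / 2),
    -((((((i : ℕ) + 1) ^ 2 * N : ℕ) : ℕ) : ℝ) * Real.log p) * weight F₀ v₀.1 = _
  have hfac : ∑ i : Fin ((l - 1) / 2), -((((((i : ℕ) + 1) ^ 2 * N : ℕ) : ℕ) : ℝ) * Real.log p) * weight F₀ v₀.1 =
      -(((N : ℝ) * weight F₀ v₀.1 * Real.log p) * ∑ i : Fin ((l - 1) / 2), (((i : ℕ) : ℝ) + 1) ^ 2) := by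
    rw [Finset.mul_sum, ← Finset.sum_neg_distrib]
    exact Finset.sum_congr rfl fun i _ => by push_cast; ring
  rw [hfac, mul_neg, mul_left_comm, avg_sum_sq_eq l hl h5]
  ring

/-- At every prime other than the deep one the (P)-summand does not move with the depth. [cite: DupuyHilado2025, §3.9, Def. 3.6.3] -/
theorem negLogThetaPerImageLoc_deepAtPlace_eq_of_ne (N N' : ℕ) (hN : 0 < N) (hN' : 0 < N') {p' : ℕ} (hp' : p' ≠ p) :
    (ThetaVolumeInput.deepAtPlace p v₀ l hl h5 N hN σ).negLogThetaPerImageLoc p' =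
      (ThetaVolumeInput.deepAtPlace p v₀ l hl h5 N' hN' σ).negLogThetaPerImageLoc p' := by
  by_cases hpr : p'.Prime
  · haveI : Fact p'.Prime := ⟨hpr⟩
    rw [(ThetaVolumeInput.deepAtPlace p v₀ l hl h5 N hN σ).negLogThetaPerImageLoc_of_prime hpr,
      (ThetaVolumeInput.deepAtPlace p v₀ l hl h5 N' hN' σ).negLogThetaPerImageLoc_of_prime hpr]
    have ht : (ThetaVolumeInput.deepAtPlace p v₀ l hl h5 N hN σ).tΘ p' hpr =
        (ThetaVolumeInput.deepAtPlace p v₀ l hl h5 N' hN' σ).tΘ p' hpr := by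
      funext i v
      have hv : v.1 ≠ v₀.1 := fun h => hp'
        (((mem_placesOver_iff_residueChar v.1).mp v.2).symm.trans (h ▸ (mem_placesOver_iff_residueChar v₀.1).mp v₀.2))
      dsimp only [ThetaVolumeInput.deepAtPlace]
      rw [if_neg hv, if_neg hv]
    exact congrArg (fun t => ((ThetaVolumeInput.deepAtPlace p v₀ l hl h5 N hN σ).packetAt p' hpr).negLogThetaPerImageAt
      ((l - 1) / 2) t) ht
  · rw [ThetaVolumeInput.negLogThetaPerImageLoc, ThetaVolumeInput.negLogThetaPerImageLoc, dif_neg hpr, dif_neg hpr]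

/-- **THE ONE-PLACE FAMILY IN READING (P), EXACT**: for `p > 2` with every `K_{v̲}` (`v | p`) absolutely unramified and every depth `N ≥ 1`,
`Cor312PerImageOf (deepAtPlace p v₀ l N σ) ↔ ((l+1)l/12 − 1)·N·β·log p ≤ c_P + ((l+5)/4)·log π` with `β = Pr(v₀)` and the depth-free
`c_P = Σ_{p' ∈ T∖{p}} negLogThetaPerImageLoc (deepAtPlace … 1 …) p'`. HYPOTHESIS-shaped on the left; synthetic input; no side taken.
[cite: Mochizuki2012, IUTchIII Cor. 3.12 p. 173–174, proof Step (x) p. 181] [claim: Mochizuki2012, status: disputed] -/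
theorem cor312PerImageOf_deepAtPlace_iff_of_unramified (hp2 : 2 < p)
    (hunram : ∀ v : placesOver F₀ p, absRamificationIdx p ((σ.localFieldFamily p hp.out).k v) = 1) (N : ℕ) (hN : 0 < N) :
    (ThetaVolumeInput.deepAtPlace p v₀ l hl h5 N hN σ).Cor312PerImageOf ↔
      (((l : ℝ) + 1) * l / 12 - 1) * ((N : ℝ) * weight F₀ v₀.1 * Real.log p) ≤
        (∑ p' ∈ (ThetaVolumeInput.deepAtPlace p v₀ l hl h5 1 Nat.one_pos σ).supportPrimes.erase p,
          (ThetaVolumeInput.deepAtPlace p v₀ l hl h5 1 Nat.one_pos σ).negLogThetaPerImageLoc p') +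
          ThetaVolumeInput.archLogTheta l := by
  classical
  have hsplit : (ThetaVolumeInput.deepAtPlace p v₀ l hl h5 N hN σ).negLogThetaPerImageNonarch =
      (ThetaVolumeInput.deepAtPlace p v₀ l hl h5 N hN σ).negLogThetaPerImageLoc p +
        ∑ p' ∈ (ThetaVolumeInput.deepAtPlace p v₀ l hl h5 N hN σ).supportPrimes.erase p,
          (ThetaVolumeInput.deepAtPlace p v₀ l hl h5 N hN σ).negLogThetaPerImageLoc p' :=
    (Finset.add_sum_erase _ _ (mem_supportPrimes_deepAtPlace p v₀ l hl h5 σ N hN)).symm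
  have hT : (ThetaVolumeInput.deepAtPlace p v₀ l hl h5 N hN σ).supportPrimes =
      (ThetaVolumeInput.deepAtPlace p v₀ l hl h5 1 Nat.one_pos σ).supportPrimes := rfl
  have hrest : ∑ p' ∈ (ThetaVolumeInput.deepAtPlace p v₀ l hl h5 N hN σ).supportPrimes.erase p,
      (ThetaVolumeInput.deepAtPlace p v₀ l hl h5 N hN σ).negLogThetaPerImageLoc p' =
      ∑ p' ∈ (ThetaVolumeInput.deepAtPlace p v₀ l hl h5 1 Nat.one_pos σ).supportPrimes.erase p,
        (ThetaVolumeInput.deepAtPlace p v₀ l hl h5 1 Nat.one_pos σ).negLogThetaPerImageLoc p' := by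
    rw [hT]
    exact Finset.sum_congr rfl fun p' hp' =>
      negLogThetaPerImageLoc_deepAtPlace_eq_of_ne p v₀ l hl h5 σ N 1 hN Nat.one_pos (Finset.ne_of_mem_erase hp')
  unfold ThetaVolumeInput.Cor312PerImageOf ThetaVolumeInput.negLogThetaPerImage
  rw [negAbsLogQ_deepAtPlace, hsplit, hrest, negLogThetaPerImageLoc_deepAtPlace_eq_of_unramified p v₀ l hl h5 σ hp2 hunram N hN]
  change _ ≤ _ + ThetaVolumeInput.archLogTheta l ↔ _
  constructor <;> intro h <;> linarith

/-- **IN READING (P) THE ONE-PLACE FAMILY IS EVENTUALLY FALSE FOR EVERY BAD MASS**: whatever `v₀` (`Pr(v₀) > 0` always), some depth `N` makes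
`Cor312PerImageOf (deepAtPlace p v₀ l N σ)` FAIL (slope `((l+1)l/12 − 1)·Pr(v₀)·log p > 0`; Archimedes). Contrast XXVIId-c: in reading (U) the
family is TRUE at every depth when `S_l(β) ≤ β`. [cite: Mochizuki2012, IUTchIII Cor. 3.12 proof Step (x) p. 181] [claim: Mochizuki2012, status: disputed] -/
theorem exists_not_cor312PerImageOf_deepAtPlace (hp2 : 2 < p)
    (hunram : ∀ v : placesOver F₀ p, absRamificationIdx p ((σ.localFieldFamily p hp.out).k v) = 1) :
    ∃ (N : ℕ) (hN : 0 < N), ¬ (ThetaVolumeInput.deepAtPlace p v₀ l hl h5 N hN σ).Cor312PerImageOf := by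
  set C : ℝ := (∑ p' ∈ (ThetaVolumeInput.deepAtPlace p v₀ l hl h5 1 Nat.one_pos σ).supportPrimes.erase p,
      (ThetaVolumeInput.deepAtPlace p v₀ l hl h5 1 Nat.one_pos σ).negLogThetaPerImageLoc p') +
      ThetaVolumeInput.archLogTheta l with hC
  set D : ℝ := (((l : ℝ) + 1) * l / 12 - 1) * (weight F₀ v₀.1 * Real.log p) with hD
  have hβ : 0 < weight F₀ v₀.1 := by
    unfold weight
    exact div_pos (by exact_mod_cast localDegree_pos F₀ v₀.1) (by exact_mod_cast Module.finrank_pos)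
  have hDpos : 0 < D := by
    have hs := slope_pos p l h5
    have hlog : 0 < Real.log p := Real.log_pos (by exact_mod_cast hp.out.one_lt)
    have hl5 : (5 : ℝ) ≤ l := by exact_mod_cast h5
    have : 0 < ((l : ℝ) + 1) * l / 12 - 1 := by nlinarith
    rw [hD]
    positivity
  obtain ⟨N, hN⟩ := exists_nat_gt (C / D)
  refine ⟨N + 1, Nat.succ_pos N, fun h => ?_⟩
  rw [cor312PerImageOf_deepAtPlace_iff_of_unramified p v₀ l hl h5 σ hp2 hunram] at h
  change (((l : ℝ) + 1) * l / 12 - 1) * ((((N + 1 : ℕ) : ℝ)) * weight F₀ v₀.1 * Real.log p) ≤ C at h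
  have h1 : C < (N : ℝ) * D := by rwa [div_lt_iff₀ hDpos] at hN
  have h2 : (((l : ℝ) + 1) * l / 12 - 1) * ((((N + 1 : ℕ) : ℝ)) * weight F₀ v₀.1 * Real.log p) = (((N : ℝ)) + 1) * D := by
    rw [hD]; push_cast; ring
  rw [h2] at h
  nlinarith

/-- **THE TWO READINGS PART WAYS ON THE SAME INPUTS**: at an unramified odd deep prime with `S_l(β) ≤ β` (`β = Pr(v₀)`,
`S_l(β) = (1/ℓ⋇)Σ_{i<ℓ⋇}(i+1)²β^{i+2}`), the one-place family satisfies the typed Cor. 3.12 at EVERY depth in reading (U) (XXVIId-c) and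
VIOLATES it at SOME depth in reading (P) — a kernel witness family for VERDICT RISK ¶7 at genuine completions (synthetic ideles).
[cite: Mochizuki2012, IUTchIII Cor. 3.12 p. 173–174, proof Step (x) p. 181] [claim: Mochizuki2012, status: disputed] -/
theorem readings_part_ways_deepAtPlace (hp2 : 2 < p)
    (hunram : ∀ v : placesOver F₀ p, absRamificationIdx p ((σ.localFieldFamily p hp.out).k v) = 1)
    (hβ : (1 / (((l - 1) / 2 : ℕ) : ℝ)) *
        ∑ i : Fin ((l - 1) / 2), (((i : ℕ) : ℝ) + 1) ^ 2 * weight F₀ v₀.1 ^ ((i : ℕ) + 1 + 1) ≤ weight F₀ v₀.1) :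
    (∀ (N : ℕ) (hN : 0 < N), (ThetaVolumeInput.deepAtPlace p v₀ l hl h5 N hN σ).Cor312Of) ∧
      (∃ (N : ℕ) (hN : 0 < N), ¬ (ThetaVolumeInput.deepAtPlace p v₀ l hl h5 N hN σ).Cor312PerImageOf) :=
  ⟨fun N hN => cor312Of_deepAtPlace_of_le p v₀ l hl h5 σ hp2 hunram hβ N hN,
    exists_not_cor312PerImageOf_deepAtPlace p v₀ l hl h5 σ hp2 hunram⟩

include hl h5 in
/-- `S_l(β) ≤ β` whenever `0 ≤ β ≤ 1/2`, for every `l` (abc-iut-w5-d018's `sum_sq_half_pow_le`: `Σ_{i<m}(i+1)²(1/2)^{i+1} ≤ m`).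
[cite: DupuyHilado2025, §3.6] -/
theorem badMassSum_le_of_le_half {β : ℝ} (h0 : 0 ≤ β) (hβ : β ≤ 1 / 2) :
    (1 / (((l - 1) / 2 : ℕ) : ℝ)) * ∑ i : Fin ((l - 1) / 2), (((i : ℕ) : ℝ) + 1) ^ 2 * β ^ ((i : ℕ) + 1 + 1) ≤ β := by
  set L : ℕ := (l - 1) / 2 with hL
  have hLpos : 0 < (L : ℝ) := by
    have : 2 ≤ L := by
      rw [hL]; have := hl.two_le; omega
    positivity
  have hle : ∑ i : Fin L, (((i : ℕ) : ℝ) + 1) ^ 2 * β ^ ((i : ℕ) + 1 + 1) ≤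
      β * ∑ i : Fin L, ((((i : ℕ) : ℝ) + 1) ^ 2 * (1 / 2 : ℝ) ^ ((i : ℕ) + 1)) := by
    rw [Finset.mul_sum]
    refine Finset.sum_le_sum fun i _ => ?_
    have hpow : β ^ ((i : ℕ) + 1) ≤ (1 / 2 : ℝ) ^ ((i : ℕ) + 1) := pow_le_pow_left₀ h0 hβ _
    have hsq : 0 ≤ (((i : ℕ) : ℝ) + 1) ^ 2 := sq_nonneg _
    calc (((i : ℕ) : ℝ) + 1) ^ 2 * β ^ ((i : ℕ) + 1 + 1) = β * ((((i : ℕ) : ℝ) + 1) ^ 2 * β ^ ((i : ℕ) + 1)) := by ring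
      _ ≤ β * ((((i : ℕ) : ℝ) + 1) ^ 2 * (1 / 2 : ℝ) ^ ((i : ℕ) + 1)) :=
          mul_le_mul_of_nonneg_left (mul_le_mul_of_nonneg_left hpow hsq) h0
  have hhalf := SplitBadPrime.sum_sq_half_pow_le L
  calc (1 / (L : ℝ)) * ∑ i : Fin L, (((i : ℕ) : ℝ) + 1) ^ 2 * β ^ ((i : ℕ) + 1 + 1)
      ≤ (1 / (L : ℝ)) * (β * (L : ℝ)) := by
        refine mul_le_mul_of_nonneg_left (hle.trans ?_) (by positivity)
        exact mul_le_mul_of_nonneg_left hhalf h0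
    _ = β := by field_simp

/-- **PART WAYS, UNCONDITIONALLY IN `l`**: if the bad place carries at most half the degree (`Pr(v₀) ≤ 1/2`, e.g. one place of local degree 1
over a prime of `F₀ ≠ ℚ` under abc-iut-w5-d018's `exists_place_two_mul_localDegree_le`), then at an unramified odd deep prime the one-place
family is TRUE at every depth in reading (U) and FALSE at some depth in reading (P). [cite: Mochizuki2012, IUTchIII Cor. 3.12 p. 173–174, proof Step (x) p. 181]
[claim: Mochizuki2012, status: disputed] -/
theorem readings_part_ways_of_weight_le_half (hp2 : 2 < p)
    (hunram : ∀ v : placesOver F₀ p, absRamificationIdx p ((σ.localFieldFamily p hp.out).k v) = 1)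
    (hhalf : weight F₀ v₀.1 ≤ 1 / 2) :
    (∀ (N : ℕ) (hN : 0 < N), (ThetaVolumeInput.deepAtPlace p v₀ l hl h5 N hN σ).Cor312Of) ∧
      (∃ (N : ℕ) (hN : 0 < N), ¬ (ThetaVolumeInput.deepAtPlace p v₀ l hl h5 N hN σ).Cor312PerImageOf) :=
  readings_part_ways_deepAtPlace p v₀ l hl h5 σ hp2 hunram
    (badMassSum_le_of_le_half l hl h5 (weight_nonneg F₀ v₀.1) hhalf)

end DeepAtPlace

end Summit.ABC.IUTFork.GenuineContent

end
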